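import Summits.Parity.BatemanHorn.Theses.RoughParitySectors
import Summits.Parity.BatemanHorn.Theorems.RoughValueTransportRoughValueLawRoughDecomposition
import Summits.Parity.BatemanHorn.Theorems.RoughParitySectorsOddSectorShareNonlinearOddBuchstabMass
import Literature.NumberTheory.Sieve.RoughCellDensity

/-!
# Crux `OddSectorShareNonlinear` (stmt-Parity-15628; route `RoughParitySectors`, rank 3) — BIRTH
# SKELETON `Lines/birth.lean` (BC3): "Alladi–Martin anatomy of the all-odd sector, cell by cell,
# RELATIVE to the prime cell; the odd Buchstab mass is half"

planner-skel-stmt-Parity-15628-0 (skeleton registrar, one-shot; route re-audit bin REPAIRABLE),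
2026-08-17. Target: the route decl
`Summit.Parity.BatemanHorn.Theses.RoughParitySectors.OddSectorShareNonlinear` BY NAME (rev 4 of
the route file), concluded by `OddSectorShareNonlinear_of` from two named stubs;
`OddSectorShareNonlinear_proof` cites the registered stubs by name (it depends on `sorryAx` only
through them). `lean check`: rc 0, errors [], sorries 2 = the two `stub_*`;
`OddSectorShareNonlinear_of` axioms `[propext, Classical.choice, Quot.sound]`.

## The crux (fixed; not restated)

For a Bateman–Horn system `f = (f₁,…,f_k)` with SOME member of degree `≥ 2`, a depth `U` and `x`,
let `R_f(x,U) = {1 ≤ n ≤ x : ∀ i, fᵢ(n) > 0 and no prime p < ⌈x^{deg fᵢ/U}⌉ divides fᵢ(n)}`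
(jointly rough set, staggered thresholds), `c₁(x,U) = #{n ∈ R : ∀ i, Ω(fᵢ(n)) = 1}` (prime cell)
and `c_odd(x,U) = #{n ∈ R : ∀ i, Ω(fᵢ(n)) odd}` (all-odd parity sector). CRUX: for every `η > 0`
there is `U₀` with, for every `U ≥ U₀`, eventually in `x`,
`|c₁(x,U)·(U e^{−γ}/2)^k − c_odd(x,U)| ≤ η·c_odd(x,U)` — inside the all-odd sector the primes
have the integer-model share `(2e^γ/U)^k`; a RATIO every Selberg twist
`a_n ↦ a_n ∏ᵢ (1 + θᵢ λ(fᵢ(n)))` fixes (the parity-immune half of the route's Bombieri dichotomy).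

## The line: odd-cell anatomy (A) ∘ odd Buchstab mass (M) ∘ the proved cell decomposition ⟹ crux

Sort the all-odd sector by the `Ω`-VECTOR `j⃗ = (Ω(fᵢ(n)))ᵢ` into CELLS `c_{j⃗}(x,U)` (`cell`).
The Hardy–Littlewood / Bateman–Horn random model — one `x^{deg fᵢ/U}`-rough integer of size
`≍ x^{deg fᵢ}` per member, all at value-depth `u = U`, independent across members at primes
`≥ x^{deg/U}` (no large prime divides two members: resultants) — predicts, for each cell,
`c_{j⃗} ≈ (∏ᵢ I_{jᵢ}(U))·c₁` with Buchstab–Alladi's densities `I_j = roughCellDensity j`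
(`I₁ = 1`, `I₂(u) = log(u−1)`, `I_{j+2}(u) = ∫₁^{u−1} I_{j+1}(t) dt/t`, `Σ_j I_j(u) = uω(u)`; for
the integers this is Alladi's theorem, PROVED in the tree with a rate:
`Literature.NumberTheory.Sieve.exists_abs_roughCell_sub_main_le`; for smooth VALUES of polynomials
the Dickman analogue is Martin's theorem under uniform Bateman–Horn, doi:10.1006/jnth.2001.2722).
The crux only sees the SUM of the odd cells; the line cuts it at the cells:

* `stub_oddCellAnatomy` (A — load-bearing; OPEN, size XL; the TRANSFER `C⁺` of the crux): for
  every `ε > 0` there is `U₀` such that for every `U ≥ U₀` and every ALL-ODD `j⃗` in the box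
  `jᵢ ≤ ⌊U⌋` other than the prime cell `1⃗` (r3), eventually in
  `x`, `|c_{j⃗}(x,U) − (∏ᵢ I_{jᵢ}(U))·c₁(x,U)| ≤ ε·c₁(x,U)`. Strictly FINER than the crux (cell by
  cell — the crux cannot see a bias of one cell compensated by another), yet, like the crux,
  invariant under every Selberg twist (all all-odd cells scale by the same `∏(1−θᵢ)`): it is NOT
  the all-cells law — that one, `stub_cellShapeGeneral` of the dead line
  `Cruxes/RoughValueLaw/Lines/omega-class-shape-split` (stmt-Parity-11390), covers the EVEN classes
  too and is Hardy–Littlewood-strength with the proved band (`primeCell_tendsto_of_parts` there);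
  restricted to the odd class and made RELATIVE (amplitude-free) it carries no parity and no
  constant. Why easier than the crux although stronger: each cell is a ratio of TWO almost-prime
  counting functions of FIXED type along `f`, and Buchstab descent on the least prime factor
  (`fᵢ(n) = p·m`, `m` a value of the cofactor pencil `fᵢ(ν + pt)/p`) turns `c_{j⃗}/c₁` into prime
  counts of pencils RELATIVE to the prime count of `f` — the relative, on-average-over-pencils form
  of Martin's hypothesis UH, in which the singular series cancel to first order; cells are testable
  one at a time (route NUMBERS: normalised shares at `x = 10⁶` ride the integer curves); the integer
  case of every cell is a theorem with a rate; and the cells of a LINEAR member in a progression are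
  landed (`stub_linearCells`, p105513).
* `stub_oddBuchstabMass` (M — PROVABLE NOW, pure calculus, size M): with
  `T(U) = Σ_{j odd, j ≤ ⌊U⌋} I_j(U)` and `A(U) = U e^{−γ}/2`, `T(U)/A(U) → 1`. Proof plan:
  `Σ_{j ≤ ⌊U⌋+1} I_j(U) = Uω(U)` (`sum_roughCellDensity_eq_mul_buchstabOmega`; the term `j = ⌊U⌋+1`
  vanishes for `j ≥ 2`), the alternating sum `a(U) = Σ_j (−1)^j I_j(U)` is `−ρ(U−1) ∈ [−1, 0]`
  (parity-split Buchstab; the GHL side has the limit form PROVED: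
  `Summit.Parity.GeneralizedHardyLittlewood.Theorems.ModelCellFacts.abs_alternating_sum_le`,
  `|Σ_{j ≤ M} (−1)^j I_j(M)| ≤ 1/(M−1)`, and `norm_modelEval_neg_one_le` for real `τ`), so
  `T = (Uω(U) − a(U))/2` and `T/A = ω(U)/e^{−γ} − a(U)/(U e^{−γ}) → 1` by
  `harman2007_buchstabOmega_tendsto_holds` (`ω → e^{−γ}`).
* The DECOMPOSITION `c_odd = Σ_{j⃗ all-odd, jᵢ ≤ ⌊U⌋} c_{j⃗}` eventually in `x` is a THEOREM of the
  tree (`Ω(fᵢ(n)) ≤ ⌊U⌋` on the rough set: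
  `Cruxes.RoughValueLaw.OmegaClassShapeSplit.RoughDecomposition.eventually_cardFactors_le_floor`,
  Theorems/RoughValueTransportRoughValueLawRoughDecomposition.lean, p100627) and is USED, not stubbed.

COMPOSITION `OddSectorShareNonlinear_of : Sig.stub_oddCellAnatomy → Sig.stub_oddBuchstabMass →
OddSectorShareNonlinear` (real proof, ≈ 110 lines): fix `(k, f)`, `η' = min η 1`; M gives `U₂` with
`|T^k − A^k| ≤ (η'/4)A^k` for `U ≥ U₂` (`Tendsto.pow`, `Metric.tendsto_atTop`); A with
`ε = η'/(4·8^k)` gives `U₁`; for `U ≥ max(U₁, U₂, 2)` and `x` large the all-odd sector is the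
fibrewise sum of the cells over `J = (odd j ≤ ⌊U⌋)^k` (`Finset.card_eq_sum_card_fiberwise` + the
tree's Ω-bound), `Σ_{J} ∏ I_{jᵢ} = T^k` (`Finset.prod_univ_sum`), the summed band is
`|c_odd − T^k c₁| ≤ #J·ε·c₁` with `#J ≤ (2U)^k ≤ 8^k A(U)^k` (`e^{−γ} ≥ 1/2` from
`γ < 2/3 < log 2`), and the arithmetic lemma `squeeze` gives `|c₁A^k − c_odd| ≤ η' c_odd ≤ η c_odd`.
Both stubs are consumed; neither alone meets the crux (A has no constant `e^{−γ}`, M has no `f`).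

WHAT THE CUT BUYS. The crux's two ingredients are separated by kind: the ARITHMETIC content is one
twist-invariant anatomy statement per cell (A), with certified model constants and a landed integer
case; the CONSTANT `(U e^{−γ}/2)^k` is pure Buchstab–Dickman calculus (M), claimable today.
Refuters can attack A cell by cell (a single biased odd cell along one `f` kills it and, summed,
bears on the crux); the foreseen layer-2 split of A is by the largest prime factor (route header,
TWO-LAYER PLAN: top cells `P⁺ > x` = cofactor-pencil primes on average / switching, versus medium
cells `P⁺ ≤ x^{1−ε}` = root-class anatomy of level `< 1`).

## BC3 probes (registrar folder `bc/probes.lean`, `bc/probes2.lean`; vocabulary + `Sig` defs only)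

For each stub `S ∈ {Sig.stub_oddCellAnatomy, Sig.stub_oddBuchstabMass}`: `S → OddSectorShareNonlinear`
and `S → _root_.BatemanHorn` by `first | exact? | simpa | aesop`, by
`first | exact? | simpa [S] | (unfold S; simpa) | aesop`, by `intro h; exact?`, and by each of
`simpa`, `simpa [S]`, `unfold S; simpa`, `aesop`, `intro h; unfold S at h; aesop`, `intro h; simp_all`,
`tauto` alone (`maxHeartbeats 400000`) — ALL FAIL (12/12 + 28/28; `exact?` against the crux dies by
whnf heartbeat exhaustion, everything else by assumption failed / unsolved goals / no progress);
informative probes (dedup `S` by `exact? | aesop`, converse `crux → S`, joint cheap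
`A → M → crux` by `exact? | aesop | simp_all`) fail too (5/5). Table in `Lines/birth.md`.

## Landed STRUCTURE around the crux (lead c1, prover-line-stmt-Parity-15628-c1-0, 2026-08-17)

Not stubs of this skeleton (a crux with registered stubs credits only registered-stub matches under
`--supports`, so these live on the stub-less route items they also serve), but they pin the exact
strength of the crux — all PROVED, kernel-checked, in `Summits/Parity/BatemanHorn/Theorems/`:
* `RoughParitySectorsRoughCountBand.lean` (p152327; CLOSES the support item `RoughCountBand`,
  stmt-Parity-15630): `Theorems.RoughCountBand.roughCountBand_proof`, and for EVERY Bateman–Horn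
  system the calibrations `primeCell_calibration` (under `BatemanHornAsymptotic f`:
  `|c₁·(log x)^k − m·x| ≤ τx` eventually, `U ≥ 4·max deg + 1`, `m = C(f)/∏deg`) and
  `roughCard_calibration` (`|#R·(log x)^k − x·m·e^{−kγ}U^k| ≤ τ·x·m·e^{−kγ}U^k`, `U ≥ U₀(τ)`).
* `RoughParitySectorsOddSectorShareNonlinearSqueezes.lean` (p152336) +
  `RoughParitySectorsOddSectorShareNonlinearExactness.lean` (closes the bookkeeping item `Assembly`,
  stmt-Parity-15632): "TWO OUT OF THREE" — per system `BatemanHornAsymptotic f ∧ P_f ⟹ A_f`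
  (`Exactness.share_of_asymptotic_of_balance`) and `BatemanHornAsymptotic f ∧ A_f ⟹ P_f`
  (`Exactness.balance_of_asymptotic_of_share`), `P_f`/`A_f` the conclusions of `RoughParityBalance` /
  `OddSectorShare*` verbatim; hence `BatemanHorn → RoughParityBalance → OddSectorShareNonlinear`,
  `oddSectorShares_iff_batemanHorn : RoughParityBalance → (OddSectorShareNonlinear ∧
  OddSectorShareLinear ↔ BatemanHorn)`, `roughParityBalance_iff_batemanHorn`. With the route's
  `closes` (`P ∧ A ⟹ BH`): MODULO THE PARITY CRUX THIS CRUX *IS* BATEMAN–HORN (systems with a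
  degree-≥2 member) — no difficulty beyond `BH ∧ P`, none less than `BH` once `P` is known; with the
  sibling P-line (`Cruxes/RoughParityBalance/Lines/birth.lean`: `P ⟸` sifted one-point Liouville
  along nonlinear members `∧` joint sign independence) `A ⟸ BH_f ∧ N_f ∧ J_f`.
* `RoughParitySectorsLinearCalibration.lean` (p156724; CLOSES the support item `LinearCalibration`,
  stmt-Parity-15631 — the INTEGER case of both cruxes): parity balance of the rough integers
  (`Theorems.LinearCalibration.parityBalance`) + the sibling line's landed `stub_integerShare`.
* `OddSectorShareNonlinear/Negative/LoadBearingHypotheses.lean` (p151644):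
  `oddSectorShareNonlinear_false_without_irreducible` — `irreducible` dropped ⟹ FALSE (witness
  `(X³)`: `Ω(n³) = 3Ω(n)` empties the prime cell, Bertrand primes fill the odd sector; `(X²)` is no
  witness). `pairwise_not_associated` is load-bearing only heuristically (`(g,g)` forces
  `c_odd(g) = 0` eventually; a proof of falsity needs `c_odd(g) > 0` frequently — parity of `Ω` on
  rough values of `g`, inaccessible); the other two fields give no refutable instance.

## Disproof used / dead lines / negatives

At birth none existed (2026-08-17T07Z): no `Disproof.lean`, no `_false_without_` theorem; now
`Theorems/OddSectorShareNonlinear/Negative/LoadBearingHypotheses.lean` (above) is the one negative.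
The Parity negatives index has three GHL entries (stmt-Parity-9541, -14832, -4218), unrelated. The
sibling crux `RoughValueLaw` (stmt-Parity-11390, route RoughValueTransport) killed its line
omega-class-shape-split because its open cell stubs, covering ALL parity classes with anchored
amplitudes, are Hardy–Littlewood-strength; stub A here is the odd-class, amplitude-free restriction,
which that verdict does not touch (it is exactly the part the twists cannot move). The route's own
why-might-fail for this crux (dark anatomy past every Type-I level,
`Literature.Barriers.Parity.FordFixedLevelBarrier`; weighted-sieve limits,
`Literature.Barriers.Parity.WeightedSieveLimit`) applies verbatim to stub A and is recorded on it.

Nearest in-tree statements (not duplicates; dedup probe fails): `stub_cellShapeGeneral` /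
`stub_thinCells` / `stub_linearCells` (stmt-Parity-11390: absolute normalisation `x/(log x)^k`,
amplitudes per parity vector, every depth `u > 2`); the route's support `LinearCalibration`
(stmt-Parity-15631: the system `(X)`, i.e. M plus Alladi); GHL `LeeYangFibres.CellParityLaw`
(single-ghost cell law for linear forms). Sources: Alladi1982 (Quart. J. Math. 33, Thm 1);
Alladi1982Moebius; doi:10.1006/jnth.2001.2722 (Martin 2002, smooth values of polynomials under UH);
MontgomeryVaughan2007 §7.2; Tenenbaum2015 III.6; BombieriAsymptoticSieve1976; Ford2004;
IwaniecInventiones1978; HalberstamRichert1974.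
-/

noncomputable section

namespace Summit.Parity.BatemanHorn.Cruxes.OddSectorShareNonlinear.Birth

open scoped BigOperators Topology Manifold Classical MeasureTheory ProbabilityTheory Matrix InnerProductSpace ComplexConjugate ContinuousMap
open Filter Set Function TopologicalSpace MeasureTheory
open Literature.NumberTheory.Sieve

/-! ## Vocabulary (the crux's inline `Finset.filter`s, verbatim, as functions of `(f, x, U)`) -/

/-- The JOINTLY ROUGH set `R_f(x,U) = {1 ≤ n ≤ x : ∀ i, fᵢ(n) > 0 and no prime p < ⌈x^{deg fᵢ/U}⌉
divides fᵢ(n)}` — VERBATIM the crux's (and route RoughValueTransport's) predicate. [folklore] -/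
def roughSet {k : ℕ} (f : Fin k → Polynomial ℤ) (x : ℕ) (U : ℝ) : Finset ℕ :=
  (Finset.Icc 1 x).filter (fun n : ℕ => ∀ i, 0 < (f i).eval (n : ℤ) ∧
    ∀ p ∈ Finset.range ⌈(x : ℝ) ^ (((f i).natDegree : ℝ) / U)⌉₊, p.Prime → ¬ ((p : ℤ) ∣ (f i).eval (n : ℤ)))

/-- The `Ω`-CELL of type `j⃗ : Fin k → ℕ`: `c_{j⃗}(x,U) = #{n ∈ R_f(x,U) : ∀ i, Ω(fᵢ(n)) = jᵢ}`.
[folklore] -/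
def cell {k : ℕ} (f : Fin k → Polynomial ℤ) (x : ℕ) (U : ℝ) (j : Fin k → ℕ) : ℕ :=
  ((roughSet f x U).filter (fun n : ℕ =>
    ∀ i, ArithmeticFunction.cardFactors (((f i).eval (n : ℤ)).toNat) = j i)).card

/-- The PRIME CELL `c₁(x,U) = #{n ∈ R_f(x,U) : ∀ i, Ω(fᵢ(n)) = 1}` — VERBATIM the crux's.
(`= cell f x U (fun _ => 1)` by `rfl`.) [folklore] -/
def primeCell {k : ℕ} (f : Fin k → Polynomial ℤ) (x : ℕ) (U : ℝ) : ℕ :=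
  ((roughSet f x U).filter (fun n : ℕ =>
    ∀ i, ArithmeticFunction.cardFactors (((f i).eval (n : ℤ)).toNat) = 1)).card

/-- The ALL-ODD PARITY SECTOR `c_odd(x,U) = #{n ∈ R_f(x,U) : ∀ i, Ω(fᵢ(n)) odd}` — VERBATIM the
crux's. [folklore] -/
def oddSector {k : ℕ} (f : Fin k → Polynomial ℤ) (x : ℕ) (U : ℝ) : ℕ :=
  ((roughSet f x U).filter (fun n : ℕ =>
    ∀ i, Odd (ArithmeticFunction.cardFactors (((f i).eval (n : ℤ)).toNat)))).card

/-- The ODD BUCHSTAB MASS of the integer model at depth `U`: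
`T(U) = Σ_{j odd, j ≤ ⌊U⌋} I_j(U)` (`I_j = roughCellDensity j`; the model cells `j ≥ U` are empty
for `j ≥ 2`, `roughCellDensity_of_le`, so for `U ≥ 1` this is the sum over ALL odd cells). By the parity-split Buchstab
identity `T(U) = (U ω(U) + ρ(U−1))/2`. [folklore] -/
def oddMass (U : ℝ) : ℝ :=
  ∑ j ∈ (Finset.range (⌊U⌋₊ + 1)).filter Odd, roughCellDensity j U

/-- The crux's base `A(U) = U·e^{−γ}/2` (so that the crux reads `c₁·A(U)^k = c_odd·(1 + o(1))`).
[folklore] -/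
def shareBase (U : ℝ) : ℝ :=
  U * Real.exp (-Real.eulerMascheroniConstant) / 2

/-! ## Stub statements (named `Sig.stub_*`; the skeleton theorem's hypotheses by name) -/

/-- STUB A — ODD-CELL ANATOMY RELATIVE TO THE PRIME CELL (load-bearing; OPEN, size XL; the
transfer `C⁺` of the crux). For every Bateman–Horn system with a member of degree `≥ 2` and every
`ε > 0` there is `U₀` such that for every depth `U ≥ U₀` and every ALL-ODD cell type `j⃗` with
`jᵢ ≤ ⌊U⌋` and `j⃗ ≠ 1⃗` (r3: the box minus the prime cell — exactly the cells the composition uses),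
eventually in `x`, `|c_{j⃗}(x,U) − (∏ᵢ I_{jᵢ}(U))·c₁(x,U)| ≤ ε·c₁(x,U)`: inside the all-odd
sector every `Ω`-cell has the INTEGER-MODEL ratio to the prime cell (Alladi's densities `I_j`,
independent across members at the staggered thresholds `uᵢ = U`). Cells with some `jᵢ > ⌊U⌋` are
empty eventually (tree: `RoughDecomposition.eventually_cardFactors_le_floor`) and have model `0`
(`roughCellDensity_of_lt`), so only the box `jᵢ ≤ ⌊U⌋` is content; `j⃗ = (1,…,1)` is trivial
(`I₁ = 1`). Invariant under every Selberg twist `a_n ↦ a_n∏(1+θᵢλ(fᵢ(n)))` (all all-odd cells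
scale by the same `∏(1−θᵢ)`), so — unlike the all-cells law (`stub_cellShapeGeneral` of
stmt-Parity-11390, Hardy–Littlewood-strength with the proved band) — it carries no parity and no
constant. Why plausibly true: it is the cell-wise content of the Bateman–Horn heuristic with the
singular series CANCELLED (ratio of two cells of the same system); integer case = Alladi's theorem
(tree, with a rate); smooth-side analogue for polynomial values = Martin's theorem under UH; route
numerics at `x = 10⁶` (`f = X²+1`, `U ∈ [3,6]`) ride the integer curves. Why it might fail: dark
anatomy past every Type-I level — prime-vs-`E₃,E₅,…` frequencies among rough values of a
degree-`≥ 2` member are not fixed by root-class data of level `x^{1−ε}` (value-level `1/deg`: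
`Literature.Barriers.Parity.FordFixedLevelBarrier`; `Literature.Barriers.Parity.WeightedSieveLimit`),
and an algebraic bias of the norm values `N(n − α)` toward particular factorisation types would
show up in ONE cell first. Leans on: `roughCellDensity` (+ `_of_lt`, `_nonneg`,
`sum_roughCellDensity_eq_mul_buchstabOmega`), `exists_abs_roughCell_sub_main_le` (integer case),
`IsBatemanHornSystem`, the landed `stub_linearCells` / `stub_thinCells` of stmt-Parity-11390 for the
linear and thin sectors. [cite: Alladi1982, Theorem 1 (integer case)] -/
def Sig.stub_oddCellAnatomy : Prop :=
  ∀ (k : ℕ) (f : Fin k → Polynomial ℤ), IsBatemanHornSystem f → (∃ i, 2 ≤ (f i).natDegree) →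
    ∀ ε : ℝ, 0 < ε → ∃ U₀ : ℝ, ∀ U : ℝ, U₀ ≤ U → ∀ j : Fin k → ℕ, (∀ i, Odd (j i)) →
      (∀ i, j i ≤ ⌊U⌋₊) → j ≠ (fun _ => 1) →
      ∀ᶠ x : ℕ in atTop,
        |(cell f x U j : ℝ) - (∏ i, roughCellDensity (j i) U) * (primeCell f x U : ℝ)| ≤
          ε * (primeCell f x U : ℝ)

/-- STUB M — THE ODD BUCHSTAB MASS IS HALF (load-bearing; PROVABLE NOW, pure calculus, size M):
`T(U)/A(U) → 1` as `U → ∞`, i.e. `Σ_{j odd, j ≤ ⌊U⌋} I_j(U) ∼ U e^{−γ}/2`. Proof plan: Buchstab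
`Σ_{j ≤ ⌊U⌋+1} I_j(U) = Uω(U)` (`sum_roughCellDensity_eq_mul_buchstabOmega` with `N = ⌊U⌋`; the
term `j = ⌊U⌋+1 ≥ 2` vanishes, `roughCellDensity_of_le`), the alternating sum
`a(u) = Σ_j (−1)^j I_j(u)` solves `a′(u) = −a(u−1)/(u−1)`, `a = −1` on `[1,2]`, so
`a(u) = −ρ(u−1) ∈ [−1,0]` (Dickman; limit form PROVED on the GHL side:
`Summit.Parity.GeneralizedHardyLittlewood.Theorems.ModelCellFacts.abs_alternating_sum_le`,
`norm_modelEval_neg_one_le`), hence `T = (Uω(U) − a(U))/2` and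
`T/A = ω(U)/e^{−γ} − a(U)/(U e^{−γ}) → 1` by `harman2007_buchstabOmega_tendsto_holds`
(`ω(U) → e^{−γ}`). Why it might fail: it should not (a theorem of calculus); cost is the bookkeeping
`cellDensity (j−1) M = roughCellDensity j M` across the two sub-problems' files.
[cite: MontgomeryVaughan2007, §7.2 (7.39)] -/
def Sig.stub_oddBuchstabMass : Prop :=
  Tendsto (fun U : ℝ => oddMass U / shareBase U) atTop (nhds 1)

/-! ## Registered stubs (the ONLY `sorry`s of this file)

Lead's reshaping (prover-line-stmt-Parity-15628-0, 2026-08-17): the two stubs keep their names and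
content but are stated with EXPANDED signatures — `Sig.stub_*` unfolded through `cell`, `primeCell`,
`roughSet`, `oddMass`, `shareBase` down to the crux's own `Finset.filter`s and Mathlib/Literature
constants — because a `Cruxes/` file is not importable from `Theorems/`, so a `--supports` file can only
match an expanded registered signature (precedent: `stub_roughDecomposition`, stmt-Parity-11390). Each is
definitionally the corresponding `Sig.stub_*` (`OddSectorShareNonlinear_proof` feeds them to
`OddSectorShareNonlinear_of` unchanged). A stub file states its theorem with exactly this text under
`open Filter` and `open Literature.NumberTheory.Sieve`. -/

/-- Registered stub A (odd-cell anatomy relative to the prime cell), EXPANDED signature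
(definitionally `Sig.stub_oddCellAnatomy`).  Reshaped r3 (lead c1, 2026-08-17): restricted to the
cells the composition actually uses — the BOX `jᵢ ≤ ⌊U⌋` (cells beyond it are empty eventually by the
tree's `eventually_cardFactors_le_floor` and are never asked) MINUS the prime cell `j⃗ = 1⃗` (trivial:
`I₁ = 1`, handled inside `OddSectorShareNonlinear_of`); strictly weaker than r2, same open core. -/
theorem stub_oddCellAnatomy :
    ∀ (k : ℕ) (f : Fin k → Polynomial ℤ), IsBatemanHornSystem f → (∃ i, 2 ≤ (f i).natDegree) →
    ∀ ε : ℝ, 0 < ε → ∃ U₀ : ℝ, ∀ U : ℝ, U₀ ≤ U → ∀ j : Fin k → ℕ, (∀ i, Odd (j i)) →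
      (∀ i, j i ≤ ⌊U⌋₊) → j ≠ (fun _ => 1) →
      ∀ᶠ x : ℕ in atTop,
        |(((((Finset.Icc 1 x).filter (fun n : ℕ => ∀ i, 0 < (f i).eval (n : ℤ) ∧
            ∀ p ∈ Finset.range ⌈(x : ℝ) ^ (((f i).natDegree : ℝ) / U)⌉₊, p.Prime →
              ¬ ((p : ℤ) ∣ (f i).eval (n : ℤ)))).filter (fun n : ℕ =>
            ∀ i, ArithmeticFunction.cardFactors (((f i).eval (n : ℤ)).toNat) = j i)).card : ℕ) : ℝ)
          - (∏ i, roughCellDensity (j i) U) *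
            (((((Finset.Icc 1 x).filter (fun n : ℕ => ∀ i, 0 < (f i).eval (n : ℤ) ∧
            ∀ p ∈ Finset.range ⌈(x : ℝ) ^ (((f i).natDegree : ℝ) / U)⌉₊, p.Prime →
              ¬ ((p : ℤ) ∣ (f i).eval (n : ℤ)))).filter (fun n : ℕ =>
            ∀ i, ArithmeticFunction.cardFactors (((f i).eval (n : ℤ)).toNat) = 1)).card : ℕ) : ℝ)|
        ≤ ε * (((((Finset.Icc 1 x).filter (fun n : ℕ => ∀ i, 0 < (f i).eval (n : ℤ) ∧
            ∀ p ∈ Finset.range ⌈(x : ℝ) ^ (((f i).natDegree : ℝ) / U)⌉₊, p.Prime →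
              ¬ ((p : ℤ) ∣ (f i).eval (n : ℤ)))).filter (fun n : ℕ =>
            ∀ i, ArithmeticFunction.cardFactors (((f i).eval (n : ℤ)).toNat) = 1)).card : ℕ) : ℝ) := by
  sorry

/- Registered stub M `stub_oddBuchstabMass` (odd Buchstab mass `Σ_{odd j ≤ ⌊U⌋} I_j(U) ∼ U e^{−γ}/2`)
is LANDED (wave 1, p148154, commit 70376bc27943):
`Summits/Parity/BatemanHorn/Theorems/RoughParitySectorsOddSectorShareNonlinearOddBuchstabMass.lean`
declares, in this very namespace,
`theorem stub_oddBuchstabMass :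
    Tendsto (fun U : ℝ => (∑ j ∈ (Finset.range (⌊U⌋₊ + 1)).filter Odd, roughCellDensity j U) /
      (U * Real.exp (-Real.eulerMascheroniConstant) / 2)) atTop (nhds 1)`
(imported above; definitionally `Sig.stub_oddBuchstabMass`). The sanity lemma below records the
match by name. -/

/-- The landed stub M is the skeleton's `Sig.stub_oddBuchstabMass` (definitional unfolding of
`oddMass`, `shareBase`). [folklore] -/
theorem stub_oddBuchstabMass_sig : Sig.stub_oddBuchstabMass := stub_oddBuchstabMass

/-! ## The composition -/

/-- The real-arithmetic squeeze at one `x`: a summed cell band `|c_odd − S·c₁| ≤ Nε·c₁`, a model band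
`|S − A| ≤ (η/4)·A` and the budget `4Nε ≤ ηA` give `|c₁A − c_odd| ≤ η·c_odd` (`0 < η ≤ 1`). [folklore] -/
theorem squeeze {c₁ co Sk Ak Nε η : ℝ} (hc₁ : 0 ≤ c₁) (hη : 0 < η) (hη1 : η ≤ 1)
    (hAk : 0 ≤ Ak) (h1 : |co - Sk * c₁| ≤ Nε * c₁) (h2 : |Sk - Ak| ≤ η / 4 * Ak)
    (h4 : 4 * Nε ≤ η * Ak) : |c₁ * Ak - co| ≤ η * co := by
  have hX : 0 ≤ Ak * c₁ := mul_nonneg hAk hc₁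
  obtain ⟨h1a, h1b⟩ := abs_sub_le_iff.1 h1
  obtain ⟨h2a, h2b⟩ := abs_sub_le_iff.1 h2
  have h2a' : Sk * c₁ ≤ (1 + η / 4) * (Ak * c₁) := by
    have := mul_le_mul_of_nonneg_right h2a hc₁; nlinarith
  have h2b' : (1 - η / 4) * (Ak * c₁) ≤ Sk * c₁ := by
    have := mul_le_mul_of_nonneg_right h2b hc₁; nlinarith
  have h4' : 4 * (Nε * c₁) ≤ η * (Ak * c₁) := by
    have := mul_le_mul_of_nonneg_right h4 hc₁; nlinarith
  have hlo : (1 - η / 2) * (Ak * c₁) ≤ co := by nlinarith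
  have hhi : co ≤ (1 + η / 2) * (Ak * c₁) := by nlinarith
  rw [abs_sub_le_iff]
  constructor
  · have h := mul_le_mul_of_nonneg_left hlo (by linarith : (0 : ℝ) ≤ 1 + η)
    nlinarith [mul_nonneg (mul_nonneg hη.le (sub_nonneg.2 hη1)) hX]
  · have h := mul_le_mul_of_nonneg_left hhi (by linarith : (0 : ℝ) ≤ 1 - η)
    nlinarith [mul_nonneg hη.le hX, mul_nonneg (mul_nonneg hη.le hη.le) hX]

/-- `e^{−γ} ≥ 1/2` (from `γ < 2/3 < log 2`), whence `A(U) ≥ U/4`. [folklore] -/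
theorem half_le_exp_neg_eulerMascheroni : (1 : ℝ) / 2 ≤ Real.exp (-Real.eulerMascheroniConstant) := by
  have h1 : Real.eulerMascheroniConstant < 2 / 3 := Real.eulerMascheroniConstant_lt_two_thirds
  have h2 : (2 : ℝ) / 3 < Real.log 2 := by have := Real.log_two_gt_d9; linarith
  have h3 : Real.exp (-(Real.log 2)) ≤ Real.exp (-Real.eulerMascheroniConstant) :=
    Real.exp_le_exp.2 (by linarith)
  rwa [Real.exp_neg, Real.exp_log two_pos, inv_eq_one_div] at h3

/-- **THE SKELETON THEOREM.** `Sig.stub_oddCellAnatomy → RoughParitySectors.OddSectorShareNonlinear`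
(after wave 1 the only hypothesis is stub A; stub M enters as the LANDED theorem
`stub_oddBuchstabMass`, p148154), a real proof (no `sorry`): at depth `U` the all-odd
sector is the disjoint union of the cells `c_{j⃗}`, `j⃗` all-odd with `jᵢ ≤ ⌊U⌋` (the tree's
`RoughDecomposition.eventually_cardFactors_le_floor`, PROVED); summing the per-cell bands (stub A,
`ε = η/(4·8^k)`) gives
`|c_odd − T(U)^k c₁| ≤ N ε c₁` with `N ≤ (2U)^k ≤ 8^k A(U)^k` cells (`Σ_{j⃗} ∏ I_{jᵢ} = T^k`,
`Finset.prod_univ_sum`); stub M gives `|T^k − A^k| ≤ (η/4) A^k` for `U ≥ U₀`; `squeeze` concludes.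
Every stub is consumed. [folklore] -/
theorem OddSectorShareNonlinear_of :
    Sig.stub_oddCellAnatomy →
      Summit.Parity.BatemanHorn.Theses.RoughParitySectors.OddSectorShareNonlinear := by
  intro hA k f hf hnl η hη
  -- stub M is LANDED (p148154): the odd Buchstab mass `T(U)/A(U) → 1`
  have hM : Sig.stub_oddBuchstabMass := stub_oddBuchstabMass_sig
  -- PROVED in the tree (route RoughValueTransport, crux RoughValueLaw, line omega-class-shape-split,
  -- p100627): eventually in `x`, `Ω(fᵢ(n)) ≤ ⌊U⌋` in every coordinate on the jointly rough set.
  have hB := fun (U : ℝ) (hU : 0 < U) =>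
    Summit.Parity.BatemanHorn.Cruxes.RoughValueLaw.OmegaClassShapeSplit.RoughDecomposition.eventually_cardFactors_le_floor
      f (fun i => hf.natDegree_pos i) hU
  show ∃ U₀ : ℝ, ∀ U : ℝ, U₀ ≤ U → ∀ᶠ x : ℕ in Filter.atTop,
    |(primeCell f x U : ℝ) * shareBase U ^ k - (oddSector f x U : ℝ)| ≤ η * (oddSector f x U : ℝ)
  -- work with η' = min η 1
  set η' : ℝ := min η 1 with hη'def
  have hη'0 : 0 < η' := lt_min hη one_pos
  have hη'1 : η' ≤ 1 := min_le_right _ _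
  have hη'le : η' ≤ η := min_le_left _ _
  -- the model: (T/A)^k → 1
  have hMk : Tendsto (fun U : ℝ => (oddMass U / shareBase U) ^ k) atTop (nhds 1) := by
    have h := hM.pow k
    simpa using h
  obtain ⟨U₂, hU₂⟩ : ∃ U₂ : ℝ, ∀ U, U₂ ≤ U → |(oddMass U / shareBase U) ^ k - 1| < η' / 4 := by
    obtain ⟨U₂, h⟩ := Metric.tendsto_atTop.1 hMk (η' / 4) (by positivity)
    exact ⟨U₂, fun U hU => by simpa [Real.dist_eq] using h U hU⟩
  -- the cells, with ε = η' / (4 * 8 ^ k)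
  obtain ⟨U₁, hU₁⟩ := hA k f hf hnl (η' / (4 * 8 ^ k)) (by positivity)
  refine ⟨max (max U₁ U₂) 2, fun U hU => ?_⟩
  have hU1 : U₁ ≤ U := le_trans (le_trans (le_max_left _ _) (le_max_left _ _)) hU
  have hU2 : U₂ ≤ U := le_trans (le_trans (le_max_right _ _) (le_max_left _ _)) hU
  have hU2' : (2 : ℝ) ≤ U := le_trans (le_max_right _ _) hU
  have hUpos : 0 < U := by linarith
  -- index sets: odd `j ≤ ⌊U⌋`, and all-odd vectors of them
  set I : Finset ℕ := (Finset.range (⌊U⌋₊ + 1)).filter Odd with hIdef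
  set J : Finset (Fin k → ℕ) := Fintype.piFinset (fun _ : Fin k => I) with hJdef
  have hJodd : ∀ j ∈ J, ∀ i, Odd (j i) := fun j hj i =>
    (Finset.mem_filter.1 (Fintype.mem_piFinset.1 hj i)).2
  have hJle : ∀ j ∈ J, ∀ i, j i ≤ ⌊U⌋₊ := fun j hj i =>
    Nat.lt_succ_iff.1 (Finset.mem_range.1 (Finset.mem_filter.1 (Fintype.mem_piFinset.1 hj i)).1)
  have hI1 : roughCellDensity 1 U = 1 := roughCellDensity_one_of_one_le (by linarith)
  -- eventually in x: every cell of J obeys its band (the prime cell `j⃗ = 1⃗` trivially: `I₁ = 1`),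
  -- and Ω ≤ ⌊U⌋ on the rough set
  have hcells : ∀ᶠ x : ℕ in atTop, ∀ j ∈ J,
      |(cell f x U j : ℝ) - (∏ i, roughCellDensity (j i) U) * (primeCell f x U : ℝ)| ≤
        η' / (4 * 8 ^ k) * (primeCell f x U : ℝ) := by
    refine (Filter.eventually_all_finset J).2 fun j hj => ?_
    by_cases hj1 : j = fun _ => 1
    · subst hj1
      refine Filter.Eventually.of_forall fun x => ?_
      have hc : cell f x U (fun _ => 1) = primeCell f x U := rfl
      have hp : (∏ i : Fin k, roughCellDensity ((fun _ : Fin k => (1 : ℕ)) i) U) = 1 := by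
        simp [hI1]
      rw [hc, hp, one_mul, sub_self, abs_zero]
      positivity
    · exact hU₁ U hU1 j (hJodd j hj) (hJle j hj) hj1
  filter_upwards [hcells, hB U hUpos] with x hx hΩ
  set c₁ : ℝ := (primeCell f x U : ℝ) with hc₁def
  have hc₁0 : 0 ≤ c₁ := Nat.cast_nonneg _
  -- (1) the all-odd sector is the disjoint union of the cells of J
  have hdecomp : (oddSector f x U : ℝ) = ∑ j ∈ J, (cell f x U j : ℝ) := by
    have H : ∀ n ∈ (roughSet f x U).filter (fun n : ℕ =>
        ∀ i, Odd (ArithmeticFunction.cardFactors (((f i).eval (n : ℤ)).toNat))),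
        (fun i => ArithmeticFunction.cardFactors (((f i).eval (n : ℤ)).toNat)) ∈ J := by
      intro n hn
      rw [Finset.mem_filter] at hn
      have hR := Finset.mem_filter.1 hn.1
      rw [hJdef, Fintype.mem_piFinset]
      intro i
      rw [hIdef, Finset.mem_filter, Finset.mem_range]
      exact ⟨Nat.lt_succ_of_le (hΩ n hR.1 hR.2 i), hn.2 i⟩
    unfold oddSector
    rw [Finset.card_eq_sum_card_fiberwise H, Nat.cast_sum]
    refine Finset.sum_congr rfl fun j hj => ?_
    unfold cell
    refine congrArg Nat.cast (congrArg Finset.card ?_)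
    ext n
    simp only [Finset.mem_filter]
    constructor
    · rintro ⟨⟨hn, -⟩, hj'⟩
      exact ⟨hn, fun i => congrFun hj' i⟩
    · rintro ⟨hn, hj'⟩
      exact ⟨⟨hn, fun i => by rw [hj' i]; exact hJodd j hj i⟩, funext hj'⟩
  -- (2) the model sum over J is T(U)^k
  have hmodel : ∑ j ∈ J, (∏ i, roughCellDensity (j i) U) = oddMass U ^ k := by
    rw [hJdef, ← Finset.prod_univ_sum (fun _ : Fin k => I) (fun _ j => roughCellDensity j U),
      Finset.prod_const, Finset.card_univ, Fintype.card_fin]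
    rfl
  -- (3) the summed band
  have hband : |(oddSector f x U : ℝ) - oddMass U ^ k * c₁| ≤
      (J.card : ℝ) * (η' / (4 * 8 ^ k)) * c₁ := by
    rw [hdecomp, ← hmodel, Finset.sum_mul, ← Finset.sum_sub_distrib]
    calc |∑ j ∈ J, ((cell f x U j : ℝ) - (∏ i, roughCellDensity (j i) U) * c₁)|
        ≤ ∑ j ∈ J, |(cell f x U j : ℝ) - (∏ i, roughCellDensity (j i) U) * c₁| :=
          Finset.abs_sum_le_sum_abs _ _
      _ ≤ ∑ j ∈ J, η' / (4 * 8 ^ k) * c₁ := Finset.sum_le_sum fun j hj => hx j hj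
      _ = (J.card : ℝ) * (η' / (4 * 8 ^ k)) * c₁ := by
          rw [Finset.sum_const, nsmul_eq_mul, mul_assoc]
  -- (4) the number of cells N ≤ (2U)^k ≤ 8^k A(U)^k, so the budget 4Nε ≤ η' A^k
  have hN : (J.card : ℝ) ≤ (2 * U) ^ k := by
    have hI : (I.card : ℝ) ≤ 2 * U := by
      have h1 : I.card ≤ ⌊U⌋₊ + 1 :=
        (Finset.card_filter_le _ _).trans (Finset.card_range _).le
      have h2 : (⌊U⌋₊ : ℝ) ≤ U := Nat.floor_le hUpos.le
      calc (I.card : ℝ) ≤ (⌊U⌋₊ : ℝ) + 1 := by exact_mod_cast h1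
        _ ≤ 2 * U := by linarith
    rw [hJdef, Fintype.card_piFinset, Finset.prod_const, Finset.card_univ, Fintype.card_fin,
      Nat.cast_pow]
    exact pow_le_pow_left₀ (Nat.cast_nonneg _) hI k
  have hAlb : U / 4 ≤ shareBase U := by
    have hγ := half_le_exp_neg_eulerMascheroni
    simp only [shareBase]
    nlinarith [mul_nonneg hUpos.le (sub_nonneg.2 hγ)]
  have hApos : 0 < shareBase U := by linarith
  have hAk0 : 0 < shareBase U ^ k := pow_pos hApos k
  have h8 : (2 * U) ^ k ≤ (8 : ℝ) ^ k * shareBase U ^ k := by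
    rw [← mul_pow]; exact pow_le_pow_left₀ (by linarith) (by linarith) k
  have h8pos : (0 : ℝ) < 8 ^ k := by positivity
  have h4 : 4 * ((J.card : ℝ) * (η' / (4 * 8 ^ k))) ≤ η' * shareBase U ^ k := by
    have hNA : (J.card : ℝ) / 8 ^ k ≤ shareBase U ^ k := by
      rw [div_le_iff₀ h8pos]
      calc (J.card : ℝ) ≤ (8 : ℝ) ^ k * shareBase U ^ k := hN.trans h8
        _ = shareBase U ^ k * 8 ^ k := mul_comm _ _
    calc 4 * ((J.card : ℝ) * (η' / (4 * 8 ^ k))) = (J.card : ℝ) / 8 ^ k * η' := by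
          field_simp
      _ ≤ shareBase U ^ k * η' := mul_le_mul_of_nonneg_right hNA hη'0.le
      _ = η' * shareBase U ^ k := mul_comm _ _
  -- (5) the model band at this depth
  have hSk : |oddMass U ^ k - shareBase U ^ k| ≤ η' / 4 * shareBase U ^ k := by
    have h := (hU₂ U hU2).le
    rw [div_pow, div_sub_one hAk0.ne', abs_div, abs_of_pos hAk0, div_le_iff₀ hAk0] at h
    exact h
  -- (6) squeeze, then η' ≤ η
  have key := squeeze hc₁0 hη'0 hη'1 hAk0.le hband hSk h4
  exact key.trans (mul_le_mul_of_nonneg_right hη'le (Nat.cast_nonneg _))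

/-- The skeleton in its final shape: the crux BY NAME from the one remaining registered stub
`stub_oddCellAnatomy` (it depends on `sorryAx` only through it; stub M is landed). [folklore] -/
theorem OddSectorShareNonlinear_proof :
    Summit.Parity.BatemanHorn.Theses.RoughParitySectors.OddSectorShareNonlinear :=
  OddSectorShareNonlinear_of stub_oddCellAnatomy

end Summit.Parity.BatemanHorn.Cruxes.OddSectorShareNonlinear.Birth

end
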